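import Mathlib
import HarnessLib
import Summits.ResolutionOfSingularities.ResolutionOfSingularities.Theorems.WildQuotientsWildQuotientResolutionS1aAuxCharts
import Summits.ResolutionOfSingularities.ResolutionOfSingularities.Theorems.WildQuotientsWildQuotientResolutionS1aKillCertCoverEq

/-!
# S1a — K-FREE FRAME, the MOVE-node producer: ADMISSIBLE centres from chart data, WITHOUT any badness hypothesis (X-scheme)

[OURS · L1 W4.5c · lead-1 g12; plan-1 A-KF v1 (S3) «a census instance … is proved with NO badness», §3.2 «NAMING per node: root/one-chart models: the
weighted filtration of the chart itself is global (N-chart); later nodes: (N-inf) = ExtendRees of ONE chart filtration whose support is CLOSED», RULING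
R-F15b (6) «IsCentreChart for the NEXT centre on it (coordinate stratum ⇒ regular sequence/regular quotient free; filtration test; trace/Veronese
bookkeeping) + idle/restricted charts off supp»] — NOT statements of the manuscript; counted 0; AI-level work, weaker than expert review. Crux
stmt-ResolutionOfSingularities-17941 `CyclicQuotientFourfolds`, line `s1a-logminvertex` v12 (`stub_reachLowerInF`).

The badness-free twins of `AuxCharts.exists_isAuxCentre_of_charts` (✓p626350) and of the sections-level cover theorem
`exists_isPrincipalCentre_filtration_eq_of_certCover` (✓p644505) WITHOUT certificates:
* ★ `exists_isAdmissibleCentre_of_charts` — finitely many CENTRE charts `(Oᵢ, 𝒦ᵢ)` of one degree `d > 0` agreeing on overlaps and covering the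
  closures of their supports glue (`KillGlue.glue`) to an ADMISSIBLE centre `J` with `J|Oᵢ = 𝒦ᵢ|Oᵢ`, `G`-stable, support between `⋃ (supp 𝒦ᵢ ∩ Oᵢ)` and
  `⋃ closure (…)`; no `badLocus` anywhere;
* ★★ `exists_isAdmissibleCentre_of_chartData` — ONE stable affine chart `O` of a model with a weighted centre `(f, w)` IN ITS RING OF SECTIONS
  (K1′-regular, `g₀`-adapted), whose zero set on `O` is CLOSED in `M.V`: an admissible centre `𝒦` of some Veronese degree `d` with `O` a centre chart,
  `(𝒦|O)_n = 𝒥ₙ(f, w)`, `supp 𝒦_d = V(f) ∩ O`, TOGETHER WITH the explicit node of `O` (sections ring, trivial grading `𝒜 _ = ⊤`, `σ = actOEquiv g₀`,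
  tautological `e`) and the trace identity — exactly the inputs of `exists_moveAtlas` / `exists_nodeData_blowupChart_pin` for the producer charts.
-/

set_option linter.dupNamespace false

noncomputable section

open CategoryTheory Limits AlgebraicGeometry TopologicalSpace Topology Opposite
open Literature.AlgebraicGeometry.Resolution Literature.AlgebraicGeometry.RelativeSpec
open Summit.ResolutionOfSingularities.ResolutionOfSingularities.Theorems.WildQuotientResolution.S1
open Summit.ResolutionOfSingularities.ResolutionOfSingularities.Theorems.WildQuotientResolution.S1.NodeAtlas
open Summit.ResolutionOfSingularities.ResolutionOfSingularities.Theorems.WildQuotientResolution.S1.ProducerStep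
open Summit.ResolutionOfSingularities.ResolutionOfSingularities.Theorems.WildQuotientResolution.S1.CoarseChart
open Summit.ResolutionOfSingularities.ResolutionOfSingularities.Theorems.WildQuotientResolution.S1.ChartData
open Summit.ResolutionOfSingularities.ResolutionOfSingularities.Theorems.WildQuotientResolution.S1.GoodCharts
open Summit.ResolutionOfSingularities.ResolutionOfSingularities.Theorems.WildQuotientResolution.S1.BlowupCharts
open Summit.ResolutionOfSingularities.ResolutionOfSingularities.Theorems.WildQuotientResolution.S1.KillableTransport
open Summit.ResolutionOfSingularities.ResolutionOfSingularities.Theorems.WildQuotientResolution.S1.ChartStable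
open Summit.ResolutionOfSingularities.ResolutionOfSingularities.Theorems.WildQuotientResolution.S1.CentreGluing
open Summit.ResolutionOfSingularities.ResolutionOfSingularities.Theorems.WildQuotientResolution.S1.ExtendRees
open Summit.ResolutionOfSingularities.ResolutionOfSingularities.Theorems.WildQuotientResolution.S1.KillFamily
open Summit.ResolutionOfSingularities.ResolutionOfSingularities.Theorems.WildQuotientResolution.S1.NodeChartAway
open Summit.ResolutionOfSingularities.ResolutionOfSingularities.Theorems.WildQuotientResolution.S1.KillGlue
open Summit.ResolutionOfSingularities.ResolutionOfSingularities.Theorems.WildQuotientResolution.S1.AuxCharts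

namespace Summit.ResolutionOfSingularities.ResolutionOfSingularities.Theorems.WildQuotientResolution.S1.GameFrame.GModel

variable {p : ℕ} {X' X₁ : Scheme.{0}} {q : X' ⟶ X₁} {G : Type} [Group G] {ρ : G →* Aut X'} {g₀ : G}

/-- ★ **AGREEING CENTRE CHARTS COVERING THEIR SUPPORT CLOSURES GLUE TO AN ADMISSIBLE CENTRE** — no badness hypothesis. (Centre charts `Oᵢ` over the support,
idle node charts off it; `G = ⟨g₀⟩` finite, separated model.) [OURS · L1 W4.5c · X-scheme] -/
theorem exists_isAdmissibleCentre_of_charts [Finite G] (hG : ∀ g : G, g ∈ Subgroup.zpowers g₀) (M : GModel p q G ρ g₀) [M.V.IsSeparated]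
    {ι : Type} [Finite ι] (O : ι → M.act.StableAffineOpens) (𝒦 : ι → ReesFiltration M.V) {d : ℕ} (hd : 0 < d)
    (hc : ∀ i, IsCentreChart p M.act g₀ (𝒦 i) d (O i))
    (hagree : ∀ i k (U : M.V.affineOpens), U.1 ≤ (O i).1 → U.1 ≤ (O k).1 → ∀ n, ((𝒦 i).filtration U).ideal n = ((𝒦 k).filtration U).ideal n)
    (hcl : ∀ i, closure ((((𝒦 i).ideal d).support : Set M.V) ∩ (O i).1) ⊆ ⋃ k, ((O k).1 : Set M.V)) :
    ∃ J : ReesFiltration M.V, IsAdmissibleCentre p M.act g₀ J d ∧ (∀ i, IsCentreChart p M.act g₀ J d (O i)) ∧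
      (∀ (g : G) (n : ℕ), (J.ideal n).comap (M.act.aut g).hom = J.ideal n) ∧
      (∀ i (hO : IsAffineOpen (O i).1) n, (J.filtration ⟨(O i).1, hO⟩).ideal n = ((𝒦 i).filtration ⟨(O i).1, hO⟩).ideal n) ∧
      (((J.ideal d).support : Set M.V) ⊆ ⋃ i, closure ((((𝒦 i).ideal d).support : Set M.V) ∩ (O i).1)) ∧
      ∀ i, (((𝒦 i).ideal d).support : Set M.V) ∩ (O i).1 ⊆ ((J.ideal d).support : Set M.V) := by
  haveI : IsLocallyNoetherian M.V := M.isLocallyNoetherian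
  let J : ReesFiltration M.V := glue M.act O 𝒦
  have hJfil : ∀ i (hO : IsAffineOpen (O i).1) n, (J.filtration ⟨(O i).1, hO⟩).ideal n = ((𝒦 i).filtration ⟨(O i).1, hO⟩).ideal n :=
    fun i hO n => filtration_glue_eq O 𝒦 (fun i => (hc i).1) hagree i n
  have hJO : ∀ i, IsCentreChart p M.act g₀ J d (O i) := fun i => isCentreChart_congr (hc i) fun hO n => hJfil i hO n
  have hGst : ∀ (g : G) (n : ℕ), (J.ideal n).comap (M.act.aut g).hom = J.ideal n := comap_aut_glue_of_isCentreChart hG O 𝒦 hc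
  have hsub : ((J.ideal d).support : Set M.V) ⊆ ⋃ i, closure ((((𝒦 i).ideal d).support : Set M.V) ∩ (O i).1) :=
    support_glue_subset (ρ := M.act) O 𝒦 d
  have hcov : ((J.ideal d).support : Set M.V) ⊆ ⋃ k, ((O k).1 : Set M.V) := hsub.trans (Set.iUnion_subset fun i => hcl i)
  have hidle : ∀ v ∉ ((J.ideal d).support : Set M.V), ∃ O'' : M.act.StableAffineOpens, v ∈ O''.1 ∧ IsIdleChart p M.act g₀ J O'' := fun v hv => by
    obtain ⟨O₀, hvO₀, hn⟩ := M.atlas v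
    obtain ⟨O'', hvO'', -, hO''W, hn''⟩ := exists_isNodeChart_le hn hvO₀ (J.ideal d).support.compl
      (preimage_support_compl M.act (fun g => hGst g d)) hv
    refine ⟨O'', hvO'', hn'', fun n => filtration_eq_top_of_disjoint _ hd ⟨O''.1, hn''.1⟩ ?_ n⟩
    rw [Set.disjoint_left]
    intro x hx hx'
    exact hO''W hx hx'
  refine ⟨J, ⟨hd, hGst, fun v => ?_⟩, hJO, hGst, hJfil, hsub, fun i => ?_⟩
  · by_cases hv : v ∈ ((J.ideal d).support : Set M.V)
    · obtain ⟨i, hvi⟩ := Set.mem_iUnion.mp (hcov hv)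
      exact ⟨O i, hvi, Or.inl (hJO i)⟩
    · obtain ⟨O'', hvO'', hI⟩ := hidle v hv
      exact ⟨O'', hvO'', Or.inr hI⟩
  · rintro v ⟨hvs, hvi⟩
    exact (AuxCharts.Model.mem_support_glue_iff M O 𝒦 (fun i => (hc i).1) hagree i d hvi).mpr hvs

/-- ★★ **ONE CHART WITH A WEIGHTED CENTRE IN ITS RING OF SECTIONS GIVES AN ADMISSIBLE MOVE, with the explicit node.** `M` a separated regular model
(`G = ⟨g₀⟩` finite, `g₀ ^ p = 1`); `O` a stable affine chart; `f : Fin c → Γ(M.V, O)` with weights `w > 0`, K1′-regular, `g₀`-adapted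
(`𝒥ₙ(f,w)` stable under `actOEquiv g₀`); the zero set `V(f) ∩ O` CLOSED in `M.V`. Then for the TRIVIAL node of `O` (grading `𝒜 _ = ⊤` on the ring of
sections, `σ = actOEquiv g₀`, tautological `e`) there are a Veronese degree `d` and an ADMISSIBLE centre `𝒦` with `O` a centre chart, `G`-stable pieces,
`(𝒦|O)_n = 𝒥ₙ(f, w) = e⁻¹(trace)`, and `supp 𝒦_d = V(f) ∩ O`. [OURS · L1 W4.5c · X-scheme MOVE producer; NOT a statement of the manuscript] -/
theorem exists_isAdmissibleCentre_of_chartData [Finite G] (hG : ∀ g : G, g ∈ Subgroup.zpowers g₀) (hg₀ : g₀ ^ p = 1)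
    (M : GModel p q G ρ g₀) [M.V.IsSeparated] (hreg : Scheme.IsRegular M.V)
    (O : M.act.StableAffineOpens) (hO : IsAffineOpen O.1)
    {c : ℕ} (f : Fin c → Γ(M.V, O.1)) (w : Fin c → ℕ) (hc : 0 < c) (hw : ∀ k, 0 < w k)
    (hK1 : RingTheory.Sequence.IsRegular Γ(M.V, O.1) (List.ofFn f))
    (hK1' : IsRegularRing (Γ(M.V, O.1) ⧸ Ideal.span (Set.range f)))
    (hσJ : ∀ n : ℕ, ((weightedFiltration f w).ideal n).map (actOEquiv M.act O g₀ : Γ(M.V, O.1) →+* Γ(M.V, O.1)) ≤ (weightedFiltration f w).ideal n)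
    (hZcl : IsClosed (M.V.zeroLocus (U := O.1) (Set.range f) ∩ (O.1 : Set M.V))) :
    ∃ (𝒜 : (Π j : Fin 0, ZMod ((![] : Fin 0 → ℕ) j)) → AddSubgroup Γ(M.V, O.1)) (_ : GradedRing 𝒜) (e : Γ(M.V, O.1) ≃+* ↥(𝒜 0))
      (𝒦 : ReesFiltration M.V) (d : ℕ),
      (∀ i, 𝒜 i = ⊤) ∧ (∀ b, ((e b : ↥(𝒜 0)) : Γ(M.V, O.1)) = b) ∧
      IsTameNode p Γ(M.V, O.1) 𝒜 (actOEquiv M.act O g₀) ∧ (∀ x, (⇑(actOEquiv M.act O g₀))^[p] x = x) ∧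
      (∀ t : Γ(M.V, O.1), ((e ((M.act.aut g₀⁻¹).hom.appLE O.1 O.1 (O.2.1 g₀⁻¹).ge t) : ↥(𝒜 0)) : Γ(M.V, O.1)) =
        actOEquiv M.act O g₀ ((e t : ↥(𝒜 0)) : Γ(M.V, O.1))) ∧
      (∀ k, f k ∈ 𝒜 ((fun _ => 0) k)) ∧ VeroneseNormalised 𝒜 f w d ∧
      IsAdmissibleCentre p M.act g₀ 𝒦 d ∧ IsCentreChart p M.act g₀ 𝒦 d O ∧
      (∀ (g : G) (n : ℕ), (𝒦.ideal n).comap (M.act.aut g).hom = 𝒦.ideal n) ∧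
      (∀ n, (𝒦.filtration ⟨O.1, hO⟩).ideal n = (weightedFiltration f w).ideal n) ∧
      (∀ n, (𝒦.filtration ⟨O.1, hO⟩).ideal n = ((traceFiltration 𝒜 f w).ideal n).comap (e : Γ(M.V, O.1) →+* ↥(𝒜 0))) ∧
      (((𝒦.ideal d).support : Set M.V)) = M.V.zeroLocus (U := O.1) (Set.range f) ∩ (O.1 : Set M.V) := by
  classical
  haveI : IsLocallyNoetherian M.V := M.isLocallyNoetherian
  -- the trivial node on the chart
  obtain ⟨𝒜, gr, h𝒜, e, he⟩ := exists_trivialGradedRing (Π j : Fin 0, ZMod ((![] : Fin 0 → ℕ) j)) Γ(M.V, O.1)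
  haveI : IsNoetherianRing Γ(M.V, O.1) := IsLocallyNoetherian.component_noetherian ⟨O.1, hO⟩
  have hregO : IsRegularRing Γ(M.V, O.1) := hreg.isRegularRing_of_isAffineOpen hO
  have hσp : ∀ x, (⇑(actOEquiv M.act O g₀))^[p] x = x := fun x => actOEquiv_iterate_eq_self M.act O hg₀ x
  have htame : IsTameNode p Γ(M.V, O.1) 𝒜 (actOEquiv M.act O g₀) := by
    refine ⟨inferInstance, hregO, ?_, ?_, ?_, hσp⟩
    · exact ⟨∅, fun _ h => absurd h (Finset.notMem_empty _), inferInstance⟩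
    · refine ⟨∅, eq_top_iff.mpr fun b _ => Subring.subset_closure (Or.inl ?_)⟩
      rw [h𝒜 0]; exact AddSubgroup.mem_top b
    · intro d' b _; rw [h𝒜 d']; exact AddSubgroup.mem_top _
  have hσ : ∀ t : Γ(M.V, O.1), ((e ((M.act.aut g₀⁻¹).hom.appLE O.1 O.1 (O.2.1 g₀⁻¹).ge t) : ↥(𝒜 0)) : Γ(M.V, O.1)) =
      actOEquiv M.act O g₀ ((e t : ↥(𝒜 0)) : Γ(M.V, O.1)) := fun t => by rw [he, he]; rfl
  have hf : ∀ k, f k ∈ 𝒜 ((fun _ => (0 : Π j : Fin 0, ZMod ((![] : Fin 0 → ℕ) j))) k) := fun k => by rw [h𝒜]; trivial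
  -- a Veronese degree
  obtain ⟨d, hd⟩ : ∃ d : ℕ, VeroneseNormalised 𝒜 f w d := by
    refine Veronese.veroneseNormalisation _ _ 𝒜 ⟨∅, ?_⟩ c f (fun _ => 0) w hf
    rw [h𝒜 0, Finset.coe_empty, Set.union_empty]
    exact top_le_iff.mp fun x _ => Subring.subset_closure trivial
  have hdpos : 0 < d := hd.1
  -- the chart filtration and its trace
  let K : IdealFiltration Γ(M.V, O.1) := weightedFiltration f w
  let 𝒦₀ : ReesFiltration M.V := chartFiltration O.1 K
  have h𝒦O : ∀ n, (𝒦₀.filtration ⟨O.1, hO⟩).ideal n = (weightedFiltration f w).ideal n := fun n => filtration_chartFiltration O.1 hO K n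
  have htrace : ∀ n, (weightedFiltration f w).ideal n = ((traceFiltration 𝒜 f w).ideal n).comap (e : Γ(M.V, O.1) →+* ↥(𝒜 0)) := by
    intro n
    ext t
    rw [Ideal.mem_comap, mem_traceFiltration_iff, RingHom.coe_coe, he]
  have h𝒦O' : ∀ n, (𝒦₀.filtration ⟨O.1, hO⟩).ideal n = ((traceFiltration 𝒜 f w).ideal n).comap (e : Γ(M.V, O.1) →+* ↥(𝒜 0)) := fun n => by
    rw [h𝒦O, htrace]
  have hcentre : IsCentreChart p M.act g₀ 𝒦₀ d O :=
    ⟨hO, 0, ![], Γ(M.V, O.1), inferInstance, 𝒜, gr, actOEquiv M.act O g₀, e, htame, hσ, c, f, fun _ => 0, w, hc, hf, hw, hK1, hK1', hσJ, h𝒦O', hd⟩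
  -- the support on the chart is `V(f) ∩ O`
  have hsuppO : (((𝒦₀.ideal d).support : Set M.V)) ∩ (O.1 : Set M.V) = M.V.zeroLocus (U := O.1) (Set.range f) ∩ (O.1 : Set M.V) := by
    ext x
    constructor
    · rintro ⟨hx, hxO⟩
      refine ⟨?_, hxO⟩
      have hZ : x ∈ M.V.zeroLocus (U := O.1) ((K.ideal d : Ideal Γ(M.V, O.1)) : Set Γ(M.V, O.1)) :=
        (mem_support_chartFiltration_iff O.1 hO K d hxO).mp hx
      have hID : Ideal.span (Set.range f) ^ d ≤ K.ideal d := by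
        have h1 : Ideal.span (Set.range f) ≤ K.ideal 1 := by
          rw [Ideal.span_le]
          rintro _ ⟨k, rfl⟩
          exact (weightedFiltration f w).antitone (hw k) (mem_weightedFiltration_ideal f w k)
        refine (Ideal.pow_right_mono h1 d).trans ?_
        have := Veronese.idealFiltration_pow_le K 1 d
        rwa [one_mul] at this
      have h2 : x ∈ M.V.zeroLocus (U := O.1) ((Ideal.span (Set.range f) ^ d : Ideal Γ(M.V, O.1)) : Set Γ(M.V, O.1)) :=
        M.V.zeroLocus_mono (SetLike.coe_subset_coe.mpr hID) hZ
      rw [← Scheme.zeroLocus_radical, Ideal.radical_pow _ hdpos.ne', Scheme.zeroLocus_radical, Scheme.zeroLocus_span] at h2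
      exact h2
    · rintro ⟨hxZ, hxO⟩
      refine ⟨?_, hxO⟩
      rw [SetLike.mem_coe, Scheme.IdealSheafData.mem_support_iff_of_mem (U := ⟨O.1, hO⟩) hxO, ← ReesFiltration.filtration_ideal, h𝒦O]
      rw [← Scheme.zeroLocus_span] at hxZ
      exact M.V.zeroLocus_mono (SetLike.coe_subset_coe.mpr (KillCert.weightedFiltration_ideal_le_span f w hdpos)) hxZ
  -- glue (one chart): admissible, `G`-stable, centre chart, traces, support
  have hcl : ∀ _ : Unit, closure ((((𝒦₀.ideal d).support : Set M.V)) ∩ (O.1 : Set M.V)) ⊆ ⋃ _ : Unit, (O.1 : Set M.V) := fun _ => by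
    rw [hsuppO, hZcl.closure_eq, Set.iUnion_const]
    exact Set.inter_subset_right
  obtain ⟨J, hJadm, hJO, hJG, hJfil, hJsub, hJsup⟩ := exists_isAdmissibleCentre_of_charts hG M (fun _ : Unit => O) (fun _ => 𝒦₀) hdpos
    (fun _ => hcentre) (fun _ _ _ _ _ _ => rfl) hcl
  have hJw : ∀ n, (J.filtration ⟨O.1, hO⟩).ideal n = (weightedFiltration f w).ideal n := fun n => by rw [hJfil () hO n, h𝒦O]
  refine ⟨𝒜, gr, e, J, d, h𝒜, he, htame, hσp, hσ, hf, hd, hJadm, hJO (), hJG, hJw, fun n => by rw [hJw, htrace], ?_⟩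
  apply le_antisymm
  · refine hJsub.trans ?_
    rw [Set.iUnion_const, hsuppO, hZcl.closure_eq]
  · rw [← hsuppO]
    exact hJsup ()

end Summit.ResolutionOfSingularities.ResolutionOfSingularities.Theorems.WildQuotientResolution.S1.GameFrame.GModel

end
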